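import Summits.CriticalPhenomena.SAWScalingLimit.Theorems.SAWTotalPositivityTPToTraversalBoundChainPieces
import Summits.CriticalPhenomena.SAWScalingLimit.Theorems.TPToTraversalBound.Negative.TPToTraversalBoundLogic

/-!
# Boundary shells for `TPToTraversalBound`: closed sub-cases and the reduction to per-shell tightness

Crux `SAWTotalPositivity.TPToTraversalBound` (stmt-CriticalPhenomena-10687), line `radial-portal-transfer`,
stub `stub_boundaryShells : BoundaryShellBound` ((H1) for shells `D(x; ρ, R)` centred OUTSIDE the open
Jordan domain, every exponent, shell-dependent threshold, constants depending on `(D, a, b)`).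
Everything here is proved; only the definition `BoundaryShellTight` names open content.

* The mesh polyline of a SAW of `Ω_δ` lies in `closure Ω` (or is constant): `toCurve_mem_closure`,
  `toCurve_eq_of_length_eq_zero`; so FAR shells (closed inner ball missing `Ω̄`) are never traversed
  (`not_hasTraversals_of_disjoint`).
* COARSE meshes: a polyline with `n` lattice steps has at most `n` separate traversals of a shell of
  width `R - ρ > 2δ` (`le_length_of_hasTraversals`, via the monotone segment index `pieceIdx`), and
  `n < #box(⌈r/δ₁⌉)` for `Ω ⊆ B̄(0, r)`, `δ ≥ δ₁` (`length_lt_card_box`); only `δ → 0` matters.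
* THIN shells `R < Cρ` are free: `K ≥ C^λ` makes the bound `≥ 1` (`law_le_bound_of_le_mul`).
* RE-CENTRING: an exterior centre whose inner ball meets `D̄` is within `ρ` of `∂D`
  (`exists_mem_frontier_dist_le`), and traversals of `D(x; ρ, R)` are traversals of `D(y; 2ρ, R - ρ)`;
  hence `BoundaryShellBound` is EQUIVALENT to its shell-by-shell form for shells centred ON `∂D` of
  aspect `≥ 4`, the threshold an existential after the shell (`boundaryShellBound_iff_frontier`).
* `boundaryShellBound_of_boundaryShellTight`: (H1) on exterior shells follows from the tightness AS
  `δ → 0`, shell by shell, of the traversal number of boundary-centred shells — the open content.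
-/

noncomputable section

open MeasureTheory Filter Topology Set Metric
open scoped NNReal ENNReal unitInterval
open Literature.Probability.LatticeModels
open Literature.Probability.RandomPlanarGeometry
open Literature.Probability.RandomPlanarGeometry.SAW
open Summit.CriticalPhenomena.SAWScalingLimit.Theses.SAWTotalPositivity
open Summit.CriticalPhenomena.SAWScalingLimit.Theorems.TPToTraversalBound.Negative (law_apply_le_one
  law_hasTraversals_anti)

namespace Summit.CriticalPhenomena.SAWScalingLimit.Theorems.TPToTraversalBound.Radial

variable {Ω : Set ℂ} {δ : ℝ} {u v : Site 2}

/-! ## The mesh polyline of a SAW lies in the closure of the domain -/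

/-- Evaluation of the curve built from a continuous map. [folklore] -/
theorem curve_mk_apply (f : C(I, ℂ)) (t : I) : (⟨f⟩ : Curve ℂ) t = f t := rfl

/-- Every vertex of a SAW of `Ω_δ` with at least one step is a vertex of `Ω_δ` (it is an endpoint of
an edge of `Ω_δ`). [folklore] -/
theorem getVert_mem_meshDomain (γ : DomainSAW Ω δ u v) (h : 0 < γ.walk.length) (n : ℕ) :
    γ.walk.getVert n ∈ meshDomain Ω δ := by
  rcases lt_or_ge n γ.walk.length with hn | hn
  · exact (discreteDomainGraph_adj_iff.1 (γ.walk.adj_getVert_succ hn)).2.1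
  · have hadj := γ.walk.adj_getVert_succ (i := γ.walk.length - 1) (by omega)
    rw [show γ.walk.length - 1 + 1 = γ.walk.length by omega, γ.walk.getVert_length] at hadj
    rw [γ.walk.getVert_of_length_le hn]
    exact (discreteDomainGraph_adj_iff.1 hadj).2.2

/-- The closed segment between consecutive mesh points of a SAW with at least one step (and the
degenerate segment at its last vertex) lies in `closure Ω`: edges of `Ω_δ` are closed segments of
`Ω̄`. [folklore] -/
theorem segment_getVert_subset_closure (γ : DomainSAW Ω δ u v) (h : 0 < γ.walk.length) (n : ℕ) :
    segment ℝ (meshPoint δ (γ.walk.getVert n)) (meshPoint δ (γ.walk.getVert (n + 1))) ⊆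
      closure Ω := by
  rcases lt_or_ge n γ.walk.length with hn | hn
  · exact (meshGraph_adj_iff.1 (discreteDomainGraph_adj_iff.1 (γ.walk.adj_getVert_succ hn)).1).2
  · rw [γ.walk.getVert_of_length_le hn, γ.walk.getVert_of_length_le (by omega), segment_same]
    have hv := meshDomain_subset_meshVertices Ω δ (getVert_mem_meshDomain γ h γ.walk.length)
    rw [γ.walk.getVert_length] at hv
    exact singleton_subset_iff.2 (subset_closure hv)

/-- **The mesh polyline of a SAW with at least one step lies in the closure of the domain.**
[folklore] -/
theorem toCurve_mem_closure (γ : DomainSAW Ω δ u v) (h : 0 < γ.walk.length) (t : I) :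
    γ.walk.toCurve (meshPoint δ) t ∈ closure Ω :=
  segment_getVert_subset_closure γ h _ (toCurve_mem_segment (meshPoint δ) γ.walk t)

/-- A SAW with no step traces the constant polyline at the mesh point of its endpoint. [folklore] -/
theorem toCurve_eq_of_length_eq_zero (γ : DomainSAW Ω δ u v) (h : γ.walk.length = 0) (t : I) :
    γ.walk.toCurve (meshPoint δ) t = meshPoint δ v := by
  have hseg := toCurve_mem_segment (meshPoint δ) γ.walk t
  rwa [γ.walk.getVert_of_length_le (by omega), γ.walk.getVert_of_length_le (by omega),
    segment_same, mem_singleton_iff] at hseg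

/-- **Far exterior shells are never traversed**: if the closed inner ball `B̄(x, ρ)` misses
`closure Ω`, no SAW polyline of `Ω_δ` has a traversal of the genuine shell `D(x; ρ, R)` (a traversal
has an endpoint in `B̄(x, ρ)`, while the polyline lies in `Ω̄` or is constant). [folklore] -/
theorem not_hasTraversals_of_disjoint (γ : DomainSAW Ω δ u v) {x : ℂ} {ρ R : ℝ} {k : ℕ}
    (hdisj : Disjoint (Metric.closedBall x ρ) (closure Ω)) (hk : k ≠ 0) (hρR : ρ < R) :
    ¬ (⟨γ.walk.toCurve (meshPoint δ)⟩ : Curve ℂ).HasTraversals k x ρ R := by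
  rintro ⟨s, t, hst, -⟩
  obtain ⟨i⟩ : Nonempty (Fin k) := Fin.pos_iff_nonempty.1 (Nat.pos_of_ne_zero hk)
  obtain ⟨p, q, hp, hq⟩ : ∃ p q : I, dist (γ.walk.toCurve (meshPoint δ) p) x ≤ ρ ∧
      R ≤ dist (γ.walk.toCurve (meshPoint δ) q) x := by
    rcases (hst i).2 with ⟨h1, h2⟩ | ⟨h1, h2⟩
    · exact ⟨_, _, h1, h2⟩
    · exact ⟨_, _, h2, h1⟩
  rcases Nat.eq_zero_or_pos γ.walk.length with h0 | h0
  · rw [toCurve_eq_of_length_eq_zero γ h0] at hp hq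
    linarith
  · exact Set.disjoint_left.1 hdisj (Metric.mem_closedBall.2 hp) (toCurve_mem_closure γ h0 p)

/-! ## A deterministic count of traversals for coarse meshes -/

/-- Two points of a segment are not further apart than its endpoints. [folklore] -/
theorem dist_le_of_mem_segment {E : Type*} [NormedAddCommGroup E] [NormedSpace ℝ E]
    {a b p q : E} (hp : p ∈ segment ℝ a b) (hq : q ∈ segment ℝ a b) : dist p q ≤ dist a b := by
  have h1 := dist_add_dist_of_mem_segment hp
  have h2 := dist_add_dist_of_mem_segment hq
  have h3 := dist_triangle p a q
  have h4 := dist_triangle p b q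
  linarith [dist_comm p a, dist_comm b q]

/-- Two points of the polyline on the same segment (same `pieceIdx`) are within `2δ`. [folklore] -/
theorem dist_toCurve_le_of_pieceIdx_eq (hδ : 0 ≤ δ) (γ : DomainSAW Ω δ u v) {s t : I}
    (h : pieceIdx γ.walk.support.tail s = pieceIdx γ.walk.support.tail t) :
    dist (γ.walk.toCurve (meshPoint δ) s) (γ.walk.toCurve (meshPoint δ) t) ≤ 2 * δ := by
  have hs := toCurve_mem_segment (meshPoint δ) γ.walk s
  have ht := toCurve_mem_segment (meshPoint δ) γ.walk t
  rw [h] at hs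
  exact (dist_le_of_mem_segment hs ht).trans (dist_meshPoint_getVert_succ_le hδ γ _)

/-- **A SAW polyline with `n` steps has at most `n` separate traversals of a shell of width `> 2δ`.**
The two endpoints of a traversal of `D(x; ρ, R)` are `≥ R - ρ > 2δ` apart, so they lie on different
segments; the segment index is monotone in time, so `k` separate traversals use `k` distinct index
jumps among the `n` available. [folklore] -/
theorem le_length_of_hasTraversals (hδ : 0 ≤ δ) (γ : DomainSAW Ω δ u v) {x : ℂ} {ρ R : ℝ} {k : ℕ}
    (hw : 2 * δ < R - ρ) (h : (⟨γ.walk.toCurve (meshPoint δ)⟩ : Curve ℂ).HasTraversals k x ρ R) :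
    k ≤ γ.walk.length := by
  obtain ⟨s, t, hst, hsep⟩ := h
  set l := γ.walk.support.tail with hl_def
  have hl : l.length = γ.walk.length := by
    simp [hl_def, SimpleGraph.Walk.length_support]
  -- every traversal jumps to a later segment
  have hjump : ∀ i, pieceIdx l (s i) < pieceIdx l (t i) := by
    intro i
    refine lt_of_le_of_ne (pieceIdx_mono l (hst i).1) fun heq => ?_
    have hd := dist_toCurve_le_of_pieceIdx_eq hδ γ heq
    have hfar : R - ρ ≤ dist (γ.walk.toCurve (meshPoint δ) (s i))
        (γ.walk.toCurve (meshPoint δ) (t i)) := by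
      have htri₁ := dist_triangle (γ.walk.toCurve (meshPoint δ) (t i))
        (γ.walk.toCurve (meshPoint δ) (s i)) x
      have htri₂ := dist_triangle (γ.walk.toCurve (meshPoint δ) (s i))
        (γ.walk.toCurve (meshPoint δ) (t i)) x
      have hsymm := dist_comm (γ.walk.toCurve (meshPoint δ) (s i))
        (γ.walk.toCurve (meshPoint δ) (t i))
      rcases (hst i).2 with ⟨h1, h2⟩ | ⟨h1, h2⟩
      · simp only [curve_mk_apply] at h1 h2
        linarith
      · simp only [curve_mk_apply] at h1 h2
        linarith
    linarith
  -- hence the `n`-th traversal ends on a segment of index `≥ n + 1`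
  have hgrow : ∀ (n : ℕ) (hn : n < k), n + 1 ≤ pieceIdx l (t ⟨n, hn⟩) := by
    intro n
    induction n with
    | zero => intro hn; have := hjump ⟨0, hn⟩; omega
    | succ n ih =>
      intro hn
      have h1 := ih (by omega)
      have hlt : (⟨n, by omega⟩ : Fin k) < ⟨n + 1, hn⟩ := Fin.mk_lt_mk.2 (Nat.lt_succ_self n)
      have h2 : pieceIdx l (t ⟨n, by omega⟩) ≤ pieceIdx l (s ⟨n + 1, hn⟩) :=
        pieceIdx_mono l (hsep hlt).le
      have h3 := hjump ⟨n + 1, hn⟩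
      omega
  rcases Nat.eq_zero_or_pos k with rfl | hk
  · exact Nat.zero_le _
  · have h1 := hgrow (k - 1) (by omega)
    have h2 := pieceIdx_le l (t ⟨k - 1, by omega⟩)
    omega

/-- For `Ω ⊆ B̄(0, r)` and meshes `δ ≥ δ₁ > 0`, every mesh vertex lies in the lattice box of
half-side `⌈r / δ₁⌉`. [folklore] -/
theorem mem_box_of_mem_meshVertices {r δ₁ : ℝ} (hΩ : Ω ⊆ Metric.closedBall 0 r) (hδ₁ : 0 < δ₁)
    (hδ : δ₁ ≤ δ) {p : Site 2} (hp : p ∈ meshVertices Ω δ) : p ∈ box 2 ⌈r / δ₁⌉₊ := by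
  have hz := hΩ hp
  rw [Metric.mem_closedBall, dist_zero_right] at hz
  have hδ0 : 0 < δ := hδ₁.trans_le hδ
  have hre := (Complex.abs_re_le_norm (meshPoint δ p)).trans hz
  have him := (Complex.abs_im_le_norm (meshPoint δ p)).trans hz
  rw [meshPoint_re] at hre; rw [meshPoint_im] at him
  have key : ∀ a : ℤ, |δ * (a : ℝ)| ≤ r → -(⌈r / δ₁⌉₊ : ℤ) ≤ a ∧ a ≤ ⌈r / δ₁⌉₊ := by
    intro a ha
    rw [abs_mul, abs_of_pos hδ0] at ha
    have h1 : |(a : ℝ)| * δ₁ ≤ r := by nlinarith [abs_nonneg (a : ℝ)]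
    have h2 : |(a : ℝ)| ≤ r / δ₁ := by rwa [le_div_iff₀ hδ₁]
    have h3 : |(a : ℝ)| ≤ (⌈r / δ₁⌉₊ : ℝ) := h2.trans (Nat.le_ceil _)
    rw [abs_le] at h3
    have h4 : ((-(⌈r / δ₁⌉₊ : ℤ) : ℤ) : ℝ) ≤ (a : ℝ) := by push_cast; linarith
    have h5 : ((a : ℤ) : ℝ) ≤ ((⌈r / δ₁⌉₊ : ℤ) : ℝ) := by push_cast; linarith
    exact ⟨by exact_mod_cast h4, by exact_mod_cast h5⟩
  rw [mem_box]
  intro i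
  fin_cases i <;> [exact key _ hre; exact key _ him]

/-- **SAW length bound for coarse meshes**: a SAW of `Ω_δ` with at least one step, `Ω ⊆ B̄(0, r)`,
`δ ≥ δ₁ > 0`, has fewer steps than the lattice box of half-side `⌈r / δ₁⌉` has sites (its vertices are
distinct sites of that box). [folklore] -/
theorem length_lt_card_box {r δ₁ : ℝ} (hΩ : Ω ⊆ Metric.closedBall 0 r) (hδ₁ : 0 < δ₁) (hδ : δ₁ ≤ δ)
    (γ : DomainSAW Ω δ u v) (h : 0 < γ.walk.length) :
    γ.walk.length < (box 2 ⌈r / δ₁⌉₊).card := by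
  classical
  have hsub : γ.walk.support.toFinset ⊆ box 2 ⌈r / δ₁⌉₊ := by
    intro p hp
    rw [List.mem_toFinset] at hp
    obtain ⟨n, rfl, -⟩ := SimpleGraph.Walk.mem_support_iff_exists_getVert.1 hp
    exact mem_box_of_mem_meshVertices hΩ hδ₁ hδ
      (meshDomain_subset_meshVertices Ω δ (getVert_mem_meshDomain γ h n))
  have hcard := Finset.card_le_card hsub
  rw [List.toFinset_card_of_nodup γ.isPath.support_nodup, SimpleGraph.Walk.length_support] at hcard
  omega

/-! ## Thin shells are free; exterior centres are close to the boundary -/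

/-- The trivial regime `R ≤ Cρ`: the bound `C^λ (ρ/R)^λ = (Cρ/R)^λ` is at least `1`. [folklore] -/
theorem one_le_rpow_mul_rpow {C lam ρ R : ℝ} (hC : 0 ≤ C) (hlam : 0 ≤ lam) (hρ : 0 < ρ) (hR : 0 < R)
    (h : R ≤ C * ρ) : 1 ≤ C ^ lam * (ρ / R) ^ lam := by
  rw [← Real.mul_rpow hC (div_pos hρ hR).le]
  refine Real.one_le_rpow ?_ hlam
  rw [mul_div_assoc', le_div_iff₀ hR]
  linarith

/-- **Thin shells are free**: for `R ≤ Cρ` and `K ≥ C^λ` the SAW probability of ANY event is below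
`K (ρ/R)^λ ≥ 1`. [folklore] -/
theorem law_le_bound_of_le_mul {C lam ρ R K : ℝ} (hC : 0 ≤ C) (hlam : 0 ≤ lam) (hρ : 0 < ρ)
    (hR : 0 < R) (h : R ≤ C * ρ) (hK : C ^ lam ≤ K) (S : Set (DomainSAW Ω δ u v)) :
    law Ω δ u v S ≤ ENNReal.ofReal (K * (ρ / R) ^ lam) :=
  (law_apply_le_one _ _ _ _ _).trans (ENNReal.one_le_ofReal.2
    ((one_le_rpow_mul_rpow hC hlam hρ hR h).trans
      (mul_le_mul_of_nonneg_right hK (Real.rpow_nonneg (div_pos hρ hR).le _))))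

/-- **An exterior centre whose inner ball meets `D̄` is within `ρ` of `∂D`**: for an open set `s`,
a point `x ∉ s` with `B̄(x, ρ) ∩ s̄ ≠ ∅` has a frontier point within `ρ` (`x` itself if `x ∈ s̄`,
otherwise a nearest point of `s̄`, which lies on `∂(s̄) ⊆ ∂s`). [folklore] -/
theorem exists_mem_frontier_dist_le {s : Set ℂ} (hs : IsOpen s) {x : ℂ} {ρ : ℝ} (hx : x ∉ s)
    (hne : (Metric.closedBall x ρ ∩ closure s).Nonempty) :
    ∃ y ∈ frontier s, dist x y ≤ ρ := by
  obtain ⟨z, hzb, hzc⟩ := hne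
  rw [Metric.mem_closedBall] at hzb
  by_cases hxc : x ∈ closure s
  · refine ⟨x, ?_, ?_⟩
    · rw [hs.frontier_eq]
      exact ⟨hxc, hx⟩
    · rw [dist_self]
      exact dist_nonneg.trans hzb
  · have hne' : (closure s)ᶜ ≠ univ := by
      intro h
      rw [Set.compl_univ_iff] at h
      simp [h] at hzc
    obtain ⟨y, hy, hdist⟩ := exists_mem_frontier_infDist_compl_eq_dist (Set.mem_compl hxc) hne'
    rw [frontier_compl] at hy; rw [compl_compl] at hdist
    refine ⟨y, frontier_closure_subset hy, ?_⟩
    rw [← hdist]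
    exact (Metric.infDist_le_dist_of_mem hzc).trans (by rwa [dist_comm])

/-- A frontier point of the open domain is not in the domain. [folklore] -/
theorem notMem_of_mem_frontier (D : DobrushinDomain) {x : ℂ} (hx : x ∈ frontier D.carrier) :
    x ∉ D.carrier := by
  rw [D.isOpen.frontier_eq] at hx
  exact hx.2

/-! ## The typed statement shell by shell, centred on the boundary -/

/-- **`BoundaryShellBound` shell by shell, centred on `∂D`.** The typed (H1) on exterior-centred
shells is EQUIVALENT to: for every exponent and `(D, a, b)` there are `K, δ₀` such that for every
SINGLE shell `D(x; ρ, R)` centred ON the boundary curve (`x ∈ ∂D`) with `0 < ρ`, `4ρ ≤ R ≤ 1`, SOME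
threshold `k` (chosen after the shell) has `P_δ(k traversals) ≤ K (ρ/R)^λ` for all `δ ≤ min(δ₀, ρ)`.
`→`: a frontier point is exterior. `←`: thin shells `R < 9ρ` are free (`K ≥ 9^λ`); a far shell has an
empty event; otherwise re-centre at `y ∈ ∂D` with `dist x y ≤ ρ` (`exists_mem_frontier_dist_le`):
`k` traversals of `D(x; ρ, R)` are `k` traversals of `D(y; 2ρ, R - ρ)` (`HasTraversals.mono`), a
boundary-centred shell of aspect `≥ 4`, and `(2ρ/(R - ρ))^λ ≤ (9/4)^λ (ρ/R)^λ`. [folklore] -/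
theorem boundaryShellBound_iff_frontier :
    BoundaryShellBound ↔ ∀ lam : ℝ, 0 < lam → ∀ (D : DobrushinDomain) (a b : ℝ → Site 2),
      IsEndpointApprox D a b → ∃ (K δ₀ : ℝ), 0 ≤ K ∧ 0 < δ₀ ∧ ∀ (x : ℂ) (ρ R : ℝ),
        x ∈ frontier D.carrier → 0 < ρ → 4 * ρ ≤ R → R ≤ 1 →
          ∃ k : ℕ, ∀ δ ∈ Set.Ioc (0 : ℝ) δ₀, δ ≤ ρ →
            law D.carrier δ (a δ) (b δ)
                {γ | (⟨γ.walk.toCurve (meshPoint δ)⟩ : Curve ℂ).HasTraversals k x ρ R}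
              ≤ ENNReal.ofReal (K * (ρ / R) ^ lam) := by
  constructor
  · intro h lam hlam D a b hab
    obtain ⟨k, K, δ₀, hK, hδ₀, hb⟩ := h lam hlam D a b hab
    exact ⟨K, δ₀, hK, hδ₀, fun x ρ R hx _ h4 hR1 => ⟨k x ρ R, fun δ hδ hδρ =>
      hb δ hδ x ρ R (notMem_of_mem_frontier D hx) hδρ (by linarith) hR1⟩⟩
  · intro h lam hlam D a b hab
    obtain ⟨K, δ₀, hK, hδ₀, hb⟩ := h lam hlam D a b hab
    choose! k hk using hb
    -- a boundary point within `ρ` of every relevant exterior centre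
    have hy : ∀ (x : ℂ) (ρ : ℝ), (x ∉ D.carrier ∧
        (Metric.closedBall x ρ ∩ closure D.carrier).Nonempty) →
        ∃ y : ℂ, y ∈ frontier D.carrier ∧ dist x y ≤ ρ := fun x ρ hxρ => by
      obtain ⟨y, hy, hd⟩ := exists_mem_frontier_dist_le D.isOpen hxρ.1 hxρ.2
      exact ⟨y, hy, hd⟩
    choose! y hyf hyd using hy
    refine ⟨fun x ρ R => max (k (y x ρ) (2 * ρ) (R - ρ)) 1,
      max (K * (9 / 4 : ℝ) ^ lam) ((9 : ℝ) ^ lam), δ₀,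
      le_max_of_le_right (by positivity), hδ₀, ?_⟩
    intro δ hδ x ρ R hx hδρ hρR hR1
    have hδ0 : 0 < δ := hδ.1
    have hρ0 : 0 < ρ := hδ0.trans_le hδρ
    have hR0 : 0 < R := hρ0.trans hρR
    have hq : 0 ≤ (ρ / R) ^ lam := Real.rpow_nonneg (div_pos hρ0 hR0).le _
    by_cases h9 : R < 9 * ρ
    · -- thin shell
      exact law_le_bound_of_le_mul (by norm_num) hlam.le hρ0 hR0 h9.le (le_max_right _ _) _
    push Not at h9
    by_cases hne : (Metric.closedBall x ρ ∩ closure D.carrier).Nonempty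
    swap
    · -- far shell: the event is empty
      have hdisj : Disjoint (Metric.closedBall x ρ) (closure D.carrier) :=
        Set.disjoint_iff_inter_eq_empty.2 (Set.not_nonempty_iff_eq_empty.1 hne)
      have h0 : law D.carrier δ (a δ) (b δ)
          {γ | (⟨γ.walk.toCurve (meshPoint δ)⟩ : Curve ℂ).HasTraversals
            (max (k (y x ρ) (2 * ρ) (R - ρ)) 1) x ρ R} = 0 :=
        measure_mono_null (fun γ hγ => not_hasTraversals_of_disjoint γ hdisj (by omega) hρR hγ)
          measure_empty
      exact h0.trans_le zero_le
    -- re-centre at the boundary point `y x ρ`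
    have hyf' := hyf x ρ ⟨hx, hne⟩
    have hyd' := hyd x ρ ⟨hx, hne⟩
    have hbound := hk (y x ρ) (2 * ρ) (R - ρ) hyf' (by linarith) (by linarith) (by linarith) δ hδ
      (by linarith)
    calc law D.carrier δ (a δ) (b δ)
          {γ | (⟨γ.walk.toCurve (meshPoint δ)⟩ : Curve ℂ).HasTraversals
            (max (k (y x ρ) (2 * ρ) (R - ρ)) 1) x ρ R}
        ≤ law D.carrier δ (a δ) (b δ)
            {γ | (⟨γ.walk.toCurve (meshPoint δ)⟩ : Curve ℂ).HasTraversals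
              (k (y x ρ) (2 * ρ) (R - ρ)) (y x ρ) (2 * ρ) (R - ρ)} := by
          refine measure_mono fun γ hγ => ?_
          exact (Curve.HasTraversals.of_le hγ (le_max_left _ _)).mono (by linarith) (by linarith)
      _ ≤ ENNReal.ofReal (K * ((2 * ρ) / (R - ρ)) ^ lam) := hbound
      _ ≤ ENNReal.ofReal (max (K * (9 / 4 : ℝ) ^ lam) ((9 : ℝ) ^ lam) * (ρ / R) ^ lam) := by
          refine ENNReal.ofReal_le_ofReal ?_
          have hratio : (2 * ρ) / (R - ρ) ≤ (9 / 4 : ℝ) * (ρ / R) := by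
            rw [div_le_iff₀ (by linarith), mul_assoc, mul_comm (ρ / R), ← mul_assoc,
              mul_div_assoc', le_div_iff₀ hR0]
            nlinarith
          have hpow : ((2 * ρ) / (R - ρ)) ^ lam ≤ (9 / 4 : ℝ) ^ lam * (ρ / R) ^ lam := by
            rw [← Real.mul_rpow (by norm_num) (div_pos hρ0 hR0).le]
            exact Real.rpow_le_rpow (div_pos (by linarith) (by linarith)).le hratio hlam.le
          calc K * ((2 * ρ) / (R - ρ)) ^ lam ≤ K * ((9 / 4 : ℝ) ^ lam * (ρ / R) ^ lam) :=
                mul_le_mul_of_nonneg_left hpow hK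
            _ = (K * (9 / 4 : ℝ) ^ lam) * (ρ / R) ^ lam := by ring
            _ ≤ _ := mul_le_mul_of_nonneg_right (le_max_left _ _) hq

/-! ## The residual content: per-shell tightness of the traversal number as `δ → 0` -/

/-- **Per-shell tightness of the traversal number of boundary-centred shells** (the isolated open
content of `stub_boundaryShells`). For every Dobrushin domain `(D; a, b)` with an endpoint
approximation and every SINGLE shell `D(x; ρ, R)` centred ON the boundary curve (`x ∈ ∂D`) with
`0 < ρ`, `4ρ ≤ R ≤ 1`: for every `ε > 0` there are a threshold `k` and a mesh bound `δ₀ > 0` such that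
for all `δ ∈ (0, δ₀]` the critical chordal SAW polyline of `D_δ` from `a δ` to `b δ` has `k` separate
traversals of the shell with probability `≤ ε`. No rate in `ρ / R`, no uniformity in the shell, no
exterior / far / thin shell and no coarse mesh is asked for. -/
def BoundaryShellTight : Prop :=
  ∀ (D : DobrushinDomain) (a b : ℝ → Site 2), IsEndpointApprox D a b →
    ∀ (x : ℂ) (ρ R : ℝ), x ∈ frontier D.carrier → 0 < ρ → 4 * ρ ≤ R → R ≤ 1 → ∀ ε : ℝ, 0 < ε →
      ∃ (k : ℕ) (δ₀ : ℝ), 0 < δ₀ ∧ ∀ δ ∈ Set.Ioc (0 : ℝ) δ₀,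
        law D.carrier δ (a δ) (b δ)
            {γ | (⟨γ.walk.toCurve (meshPoint δ)⟩ : Curve ℂ).HasTraversals k x ρ R}
          ≤ ENNReal.ofReal ε

/-- **Reduction (proved): per-shell tightness of the traversal number gives (H1) on all
exterior-centred shells, with every exponent.** By `boundaryShellBound_iff_frontier` it suffices to
serve boundary-centred shells of aspect `≥ 4` one at a time, with `K = 1`, `δ₀ = 1`: for the shell
`D(x; ρ, R)` take `k = max k₀ (#box(⌈r/δ₁⌉) + 1)` where `(k₀, δ₁)` are its tightness data at level
`ε = (ρ/R)^λ` and `D ⊆ B̄(0, r)`; for `δ ≤ δ₁` tightness applies, and for `δ₁ < δ ≤ ρ` no SAW has `k`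
traversals (`le_length_of_hasTraversals` with `R - ρ ≥ 3ρ ≥ 3δ > 2δ`, `length_lt_card_box`).
[folklore] -/
theorem boundaryShellBound_of_boundaryShellTight : BoundaryShellTight → BoundaryShellBound := by
  intro hT
  refine boundaryShellBound_iff_frontier.2 fun lam hlam D a b hab => ?_
  obtain ⟨r, hr⟩ := (Metric.isBounded_iff_subset_closedBall (0 : ℂ)).1 D.isBounded
  refine ⟨1, 1, zero_le_one, one_pos, fun x ρ R hx hρ0 h4 hR1 => ?_⟩
  have hR0 : 0 < R := by linarith
  obtain ⟨k₀, δ₁, hδ₁, hk₀⟩ :=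
    hT D a b hab x ρ R hx hρ0 h4 hR1 _ (Real.rpow_pos_of_pos (div_pos hρ0 hR0) lam)
  refine ⟨max k₀ ((box 2 ⌈r / δ₁⌉₊).card + 1), fun δ hδ hδρ => ?_⟩
  rw [one_mul]
  by_cases hfine : δ ≤ δ₁
  · -- fine mesh: tightness at level `(ρ / R) ^ λ`
    exact (law_hasTraversals_anti (le_max_left _ _) x ρ R).trans (hk₀ δ ⟨hδ.1, hfine⟩)
  · -- coarse mesh: no SAW has that many traversals
    push Not at hfine
    have hw : 2 * δ < R - ρ := by linarith [hδ.1]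
    have h0 : law D.carrier δ (a δ) (b δ)
        {γ | (⟨γ.walk.toCurve (meshPoint δ)⟩ : Curve ℂ).HasTraversals
          (max k₀ ((box 2 ⌈r / δ₁⌉₊).card + 1)) x ρ R} = 0 := by
      refine measure_mono_null (fun γ hγ => ?_) measure_empty
      have hL := le_length_of_hasTraversals hδ.1.le γ hw
        (Curve.HasTraversals.of_le hγ (le_max_right _ _))
      have hlt := length_lt_card_box hr hδ₁ hfine.le γ (by omega)
      omega
    exact h0.trans_le zero_le

end Summit.CriticalPhenomena.SAWScalingLimit.Theorems.TPToTraversalBound.Radial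

end
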